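import Mathlib
import Summits.Ventures.LatticeQCDFlow.TrivializingMaps.QuasiLocalDecorrelation
import Summits.Ventures.LatticeQCDFlow.TrivializingMaps.LoopActionPolynomials
import Summits.Ventures.LatticeQCDFlow.TrivializingMaps.FlowLightCone
import HarnessLib

/-!
HONEST FRAMING: exact (Metropolis-corrected) sampling algorithms for lattice gauge theory; figures of
merit are autocorrelation/cost numbers at stated couplings and volumes; no continuum-physics claim.

# LightConeClustering — a trivializing map with a light cone forces clustering of its target
# (THEORY-1.md §27: locality of exact transport ⇒ decay of correlations)

Proposed tree path: `Summits/Ventures/LatticeQCDFlow/TrivializingMaps/LightConeClustering.lean`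
(OURS — venture work, never `Literature/`). Cell `lqcd-flow` (pub-lqcd), unit `pub-lqcd-theory1-g18`,
2026-08-21.  Imports: Mathlib, HarnessLib, the tree files `QuasiLocalDecorrelation` (PROPOSITION R′ and
its lemmas `abs_cov_sub_cov_le`, `integral_mul_eq_of_dependsOn_sets`, `readClosure`),
`LoopActionPolynomials` (plaquette-ball geometry: `linkBall_add`, `mem_linkBall_comm`, `self_mem_linkBall`,
`plaqNbhd_subset_linkBall_one`) and `FlowLightCone` (`frobenius_norm_coe_SU_le`).  Everything PROVED,
0 sorries, no new definitions.

## The statement (THEOREM C — "local transport clusters")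

Let `S` be any action on `SU(n)`-valued link fields of the periodic lattice `(ℤ/L)^d` and `F` an EXACT
trivializing map of it (`IsTrivializingMap S F`: `F` measurable and `F_* (⊗_links Haar) = μ_S`, the
normalised Boltzmann law `boltzmannMeasure S`).  Suppose `F` has an `m`-BALL INFLUENCE BOUND `η`:
changing the input outside the plaquette ball `linkBall m e₀` moves the output link `e₀` by at most
`η` in Frobenius norm (`‖(F V)_{e₀} - (F V')_{e₀}‖_F ≤ η` whenever `V = V'` on `linkBall m e₀`).  Then
for every pair of bounded measurable observables `|A| ≤ a`, `|B| ≤ b` that are LINK-LIPSCHITZ on link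
sets `S_A`, `S_B` (`|A U - A U'| ≤ ℓ_A · η'` whenever `‖U_e - U'_e‖_F ≤ η'` for all `e ∈ S_A`; this
contains `DependsOn A S_A`) at PLAQUETTE DISTANCE `> 2m` (`e' ∉ linkBall (2m) e` for `e ∈ S_A`,
`e' ∈ S_B`):

  `|⟨A B⟩_S - ⟨A⟩_S ⟨B⟩_S| ≤ 2 (ℓ_A b + a ℓ_B) · η`            (`abs_cov_boltzmann_le_of_ballInfluence`).

With an EXPONENTIAL light cone `η = η₀ λ^{-m}` (level form, as THEOREM L / L-ω / L-G deliver it: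
`ballInfluence_of_levelCone`) this is exponential clustering of `μ_S` with rate `½ log λ` per unit of
plaquette distance, i.e. a correlation-length bound `ξ ≤ 2 / log λ` — for EVERY action that admits such a
map, at every volume at which it does, with the map's constants.  The strong-coupling Wilson instance
(`|β| < β₀(d,n)`, constants of THEOREM L-G, uniform in `L`) is the sequel file
`StrongCouplingDecorrelation.lean`.

## Proof

The FREEZE APPROXIMANT `Ψ V e := F(V frozen to 1 outside linkBall m e) e` reads only `linkBall m e`
(range `m` in plaquette distance) and is `η`-close to `F` link by link, by the influence bound; supports at
plaquette distance `> 2m` have disjoint read-closures (`linkBall_add`, `mem_linkBall_comm`); PROPOSITION R′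
(`QuasiLocalDecorrelation`, here in the disjoint-read-closure form `abs_cov_pushforward_le_of_approx_of_disjoint`)
does the rest: under `⊗ Haar` the frozen observables are exactly independent and the true ones are
`ℓ η`-close to them.

## Reading for the venture (locality ⇄ exactness, both directions now in the tree)

PROPOSITION R (`FiniteRangeDecorrelation`): an `ε`-exact map of range `r` forces `r ≥ ½ ξ log(c/3ε)` —
the target's correlations LOWER-bound the footprint of any (machine-learned or analytic) exact sampler
map.  THEOREM C (here): an exact map's light cone UPPER-bounds the target's correlations — a flow that
trivializes exactly is never more local than `ξ/2`, and conversely a provably local exact flow (THEOREM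
L-G at strong coupling) PROVES clustering of its target.  This is the lattice-gauge analogue of
"Lipschitz transport maps transfer functional inequalities" (Caffarelli contraction; Kim–Milman
arXiv:1101.4364; Mikulincer–Shenfeld arXiv:2201.01382), with LOCALITY in place of Lipschitz bounds and
DECORRELATION in place of Poincaré / log-Sobolev.

RELATED TREE RESULTS (nothing imported from them): strong-coupling clustering is PROVED in the tree's
Literature by the Osterwalder–Seiler cluster expansion for FREE boundary conditions on cubes of `ℤ^d`,
any compact `G`, rate `(Cβ)^{4‖a‖}` (`Literature.MathematicalPhysics.QuantumFieldTheory.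
osterwalderSeiler_clustering_supNorm_holds`, `StrongCouplingExpansion`), and for the periodic SU(N)
states / their infinite-volume limit by the Shen–Zhu–Zhu Langevin coupling
(`shenZhuZhu_strongCoupling_holds`).  THEOREM C is a third mechanism (measure transport + product
independence), weaker in rate where they overlap, whose point is the EQUIVALENCE OF SCALES between the
locality of exact sampler maps and the correlation length — the quantity the venture's cost laws are
written in.
-/

namespace Summit.Ventures.LatticeQCDFlow.TrivializingMaps

open MeasureTheory ProbabilityTheory Set
open scoped Matrix Matrix.Norms.Frobenius
open Literature.MathematicalPhysics.QuantumFieldTheory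
open Literature.MathematicalPhysics.QuantumFieldTheory.Luscher2010
open Literature.MathematicalPhysics.QuantumFieldTheory.WilsonFlow (coeConfig coeConfig_apply continuous_coeConfig)

/-! ## 1. PROPOSITION R′ with disjoint read-closures (the form used below) -/

section Abstract

variable {ι : Type*} [Fintype ι] {α : Type*} [MeasurableSpace α]
variable (μ₀ : Measure α) [IsProbabilityMeasure μ₀]

/-- **PROPOSITION R′, disjoint-read-closure form.**  As `abs_cov_pushforward_le_of_approx`
(`QuasiLocalDecorrelation`), with the metric hypotheses replaced by their only use: the read-closures of
the two supports under the approximant's read-sets are disjoint. [ours] -/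
theorem abs_cov_pushforward_le_of_approx_of_disjoint {Φ Ψ : (ι → α) → (ι → α)} (hΦm : Measurable Φ)
    (hΨm : Measurable Ψ) {N : ι → Set ι} (hΨ : ∀ i, DependsOn (fun W => Ψ W i) (N i))
    {A B : (ι → α) → ℝ} (hAm : Measurable A) (hBm : Measurable B) {a b : ℝ}
    (hAa : ∀ x, |A x| ≤ a) (hBb : ∀ x, |B x| ≤ b) {S T : Set ι} (hA : DependsOn A S)
    (hB : DependsOn B T) (hdisj : Disjoint (readClosure N S) (readClosure N T)) {δA δB : ℝ}
    (hδA : ∀ V, |A (Φ V) - A (Ψ V)| ≤ δA) (hδB : ∀ V, |B (Φ V) - B (Ψ V)| ≤ δB) :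
    |∫ U, A U * B U ∂(Measure.pi fun _ : ι => μ₀).map Φ -
        (∫ U, A U ∂(Measure.pi fun _ : ι => μ₀).map Φ) *
          ∫ U, B U ∂(Measure.pi fun _ : ι => μ₀).map Φ| ≤ 2 * (δA * b + a * δB) := by
  have hABm : AEStronglyMeasurable (fun U => A U * B U) ((Measure.pi fun _ : ι => μ₀).map Φ) :=
    (hAm.mul hBm).aestronglyMeasurable
  rw [integral_map hΦm.aemeasurable hABm, integral_map hΦm.aemeasurable hAm.aestronglyMeasurable,
    integral_map hΦm.aemeasurable hBm.aestronglyMeasurable]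
  have h0 : ∫ V, A (Ψ V) * B (Ψ V) ∂Measure.pi (fun _ : ι => μ₀) -
      (∫ V, A (Ψ V) ∂Measure.pi (fun _ : ι => μ₀)) * ∫ V, B (Ψ V) ∂Measure.pi (fun _ : ι => μ₀) = 0 :=
    sub_eq_zero.2 (integral_mul_eq_of_dependsOn_sets μ₀ hdisj (hAm.comp hΨm) (hBm.comp hΨm)
      (DependsOn.comp_fieldMap hΨ hA) (DependsOn.comp_fieldMap hΨ hB))
  have := abs_cov_sub_cov_le (Measure.pi fun _ : ι => μ₀) (f := fun V => A (Φ V))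
    (f' := fun V => A (Ψ V)) (g := fun V => B (Φ V)) (g' := fun V => B (Ψ V)) (hAm.comp hΦm)
    (hAm.comp hΨm) (hBm.comp hΦm) (hBm.comp hΨm) (fun V => hAa _) (fun V => hAa _) (fun V => hBb _)
    (fun V => hBb _) hδA hδB
  rwa [h0, sub_zero] at this

end Abstract

/-! ## 2. Freezing a configuration outside a set of links -/

section Freeze

variable {ι α : Type*}

/-- Freezing outside `s` (keep `V` on `s`, the reference `V₀` elsewhere) depends only on the links in
`s`. [folklore] -/
theorem dependsOn_piecewise_config (s : Set ι) [DecidablePred (· ∈ s)] (V₀ : ι → α) :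
    DependsOn (fun V : ι → α => s.piecewise V V₀) s := by
  intro V V' h
  funext i
  by_cases hi : i ∈ s
  · simp only [Set.piecewise, hi, if_true, h i hi]
  · simp only [Set.piecewise, hi, if_false]

/-- Freezing outside `s` is measurable for the product σ-algebra. [folklore] -/
theorem measurable_piecewise_config [MeasurableSpace α] (s : Set ι) [DecidablePred (· ∈ s)]
    (V₀ : ι → α) : Measurable fun V : ι → α => s.piecewise V V₀ := by
  refine measurable_pi_iff.2 fun i => ?_
  by_cases hi : i ∈ s
  · simp only [Set.piecewise, hi, if_true]
    exact measurable_pi_apply i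
  · simp only [Set.piecewise, hi, if_false]
    exact measurable_const

/-- The frozen configuration agrees with the original on `s`. [folklore] -/
theorem piecewise_config_eq_of_mem (s : Set ι) [DecidablePred (· ∈ s)] (V V₀ : ι → α) {i : ι}
    (hi : i ∈ s) : s.piecewise V V₀ i = V i := by
  simp only [Set.piecewise, hi, if_true]

end Freeze

/-! ## 3. Plaquette-ball geometry: separated supports have disjoint read-closures -/

section Geometry

variable {d L : ℕ}

/-- Plaquette balls of radius `m` about two links at plaquette distance `> 2m` are disjoint (triangle
inequality `linkBall_add` and symmetry `mem_linkBall_comm` of the plaquette-adjacency graph). [ours] -/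
theorem disjoint_linkBall_of_not_mem {m : ℕ} {e e' : Edge d L} (h : e' ∉ linkBall (2 * m) e) :
    Disjoint (linkBall m e) (linkBall m e') := by
  rw [Set.disjoint_left]
  intro e'' h1 h2
  apply h
  rw [two_mul]
  exact linkBall_add h1 ((mem_linkBall_comm m e' e'').1 h2)

/-- Supports at plaquette distance `> 2m` have disjoint read-closures under radius-`m` plaquette-ball
read-sets. [ours] -/
theorem disjoint_readClosure_linkBall {m : ℕ} {S T : Set (Edge d L)}
    (hsep : ∀ e ∈ S, ∀ e' ∈ T, e' ∉ linkBall (2 * m) e) :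
    Disjoint (readClosure (fun e => linkBall m e) S) (readClosure (fun e => linkBall m e) T) := by
  rw [Set.disjoint_left]
  intro k hkS hkT
  obtain ⟨i, hi, hki⟩ := mem_readClosure.1 hkS
  obtain ⟨j, hj, hkj⟩ := mem_readClosure.1 hkT
  exact Set.disjoint_left.1 (disjoint_linkBall_of_not_mem (hsep i hi j hj)) hki hkj

end Geometry

/-! ## 4. From a level-form light cone to the ball influence bound -/

section LevelCone

variable {d L n : ℕ} [NeZero L]

omit [NeZero L] in
/-- **Ball form of a level-form light cone.**  If a field map `F` satisfies, for EVERY level function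
that grows by at most one across a plaquette, `‖(F V)_e - (F V')_e‖_F ≤ η₀ / λ^{lvl e}` whenever `V = V'`
at all links of level `≥ 1` (the conclusion shape of THEOREM L / L-ω / L-G), then inputs agreeing on the
plaquette ball `linkBall m e₀` give outputs at `e₀` within `η₀ / λ^m`: take the level function
`lvl e = max {j ≤ m : linkBall j e ⊆ linkBall m e₀}` ("`m` minus the plaquette distance to `e₀`"; lean-2's
`ballLevel 1 m e₀` of `TruncatedFlowLightCone`, inlined here to keep the imports light). [ours] -/
theorem ballInfluence_of_levelCone
    {F : GaugeConfig d L (Matrix.specialUnitaryGroup (Fin n) ℂ) →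
      GaugeConfig d L (Matrix.specialUnitaryGroup (Fin n) ℂ)} {lam η₀ : ℝ}
    (hcone : ∀ lvl : Edge d L → ℕ, (∀ e, ∀ e' ∈ plaqNbhd e, lvl e ≤ lvl e' + 1) →
      ∀ V V' : GaugeConfig d L (Matrix.specialUnitaryGroup (Fin n) ℂ), (∀ e, 1 ≤ lvl e → V e = V' e) →
        ∀ e, ‖coeConfig (F V) e - coeConfig (F V') e‖ ≤ η₀ / lam ^ lvl e)
    (m : ℕ) (e₀ : Edge d L) (V V' : GaugeConfig d L (Matrix.specialUnitaryGroup (Fin n) ℂ))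
    (hVV' : ∀ e ∈ linkBall m e₀, V e = V' e) :
    ‖coeConfig (F V) e₀ - coeConfig (F V') e₀‖ ≤ η₀ / lam ^ m := by
  classical
  -- the level function `m - dist(e, e₀)`, as a `findGreatest`
  let P : Edge d L → ℕ → Prop := fun e j => linkBall j e ⊆ linkBall m e₀
  let lvl : Edge d L → ℕ := fun e => Nat.findGreatest (P e) m
  have hlvl_le : ∀ e, lvl e ≤ m := fun e => Nat.findGreatest_le m
  have hP_of_pos : ∀ e, 1 ≤ lvl e → P e (lvl e) := fun e he =>
    Nat.findGreatest_of_ne_zero (P := P e) (n := m) rfl (by omega)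
  -- (L1) the centre has level `m`
  have h1 : lvl e₀ = m := Nat.findGreatest_eq (P := P e₀) subset_rfl
  -- (L2) positive level ⇒ inside the ball
  have h2 : ∀ e, 1 ≤ lvl e → e ∈ linkBall m e₀ := fun e he =>
    hP_of_pos e he (self_mem_linkBall _ e)
  -- (L3) the level grows by at most one across a plaquette (triangle inequality `linkBall_add`)
  have h3 : ∀ e, ∀ e' ∈ plaqNbhd e, lvl e ≤ lvl e' + 1 := by
    intro e e' he'
    have he1 : e' ∈ linkBall 1 e := plaqNbhd_subset_linkBall_one e he'
    rcases Nat.eq_zero_or_pos (lvl e) with h0 | hpos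
    · omega
    · have hPj : P e (lvl e) := hP_of_pos e hpos
      have hP' : P e' (lvl e - 1) := by
        intro e'' he''
        have h := linkBall_add he1 he''
        refine hPj (linkBall_mono (le_of_eq ?_) e h)
        omega
      have hle : lvl e - 1 ≤ lvl e' :=
        Nat.le_findGreatest (P := P e') (by have := hlvl_le e; omega) hP'
      omega
  have h := hcone lvl h3 V V' (fun e he => hVV' e (h2 e he)) e₀
  simpa only [h1] using h

end LevelCone

/-! ## 5. THEOREM C — an exact trivializing map with a light cone forces clustering of its target -/

section TheoremC

variable {d L n : ℕ} [NeZero L]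

omit [NeZero L] in
/-- A link-Lipschitz observable depends only on its link set (the case `η' = 0` of the Lipschitz
hypothesis). [ours] -/
theorem dependsOn_of_linkLipschitz {A : GaugeConfig d L (Matrix.specialUnitaryGroup (Fin n) ℂ) → ℝ}
    {S : Set (Edge d L)} {ℓ : ℝ}
    (hlip : ∀ (U U' : GaugeConfig d L (Matrix.specialUnitaryGroup (Fin n) ℂ)) (η : ℝ), 0 ≤ η →
      (∀ e ∈ S, ‖coeConfig U e - coeConfig U' e‖ ≤ η) → |A U - A U'| ≤ ℓ * η) :
    DependsOn A S := by
  intro U U' h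
  have h0 := hlip U U' 0 le_rfl fun e he => by
    rw [coeConfig_apply, coeConfig_apply, h e he, sub_self, norm_zero]
  rw [mul_zero] at h0
  exact sub_eq_zero.1 (abs_nonpos_iff.1 h0)

/-- **THEOREM C (local transport clusters).**  Let `F` be an exact trivializing map of the action `S`
(`F_* ⊗Haar = μ_S`) with the `m`-ball influence bound `η ≥ 0` in Frobenius norm.  Then for bounded
measurable observables `|A| ≤ a`, `|B| ≤ b`, link-Lipschitz with constants `ℓ_A` on `S_A` and `ℓ_B` on
`S_B`, and supports at plaquette distance `> 2m`:
`|∫ A B dμ_S - (∫ A dμ_S)(∫ B dμ_S)| ≤ 2 (ℓ_A b + a ℓ_B) η`.  Nothing here depends on the form of `S`;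
the volume enters only through whatever `η = η(m)` the map admits. [ours] -/
theorem abs_cov_boltzmann_le_of_ballInfluence
    {S : GaugeConfig d L (Matrix.specialUnitaryGroup (Fin n) ℂ) → ℝ}
    {F : GaugeConfig d L (Matrix.specialUnitaryGroup (Fin n) ℂ) →
      GaugeConfig d L (Matrix.specialUnitaryGroup (Fin n) ℂ)}
    (hF : IsTrivializingMap S F) {m : ℕ} {η : ℝ} (hη : 0 ≤ η)
    (hcone : ∀ (e₀ : Edge d L) (V V' : GaugeConfig d L (Matrix.specialUnitaryGroup (Fin n) ℂ)),
      (∀ e ∈ linkBall m e₀, V e = V' e) → ‖coeConfig (F V) e₀ - coeConfig (F V') e₀‖ ≤ η)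
    {A B : GaugeConfig d L (Matrix.specialUnitaryGroup (Fin n) ℂ) → ℝ} (hAm : Measurable A)
    (hBm : Measurable B) {a b ℓA ℓB : ℝ} (hAa : ∀ U, |A U| ≤ a) (hBb : ∀ U, |B U| ≤ b)
    {SA SB : Set (Edge d L)}
    (hAlip : ∀ (U U' : GaugeConfig d L (Matrix.specialUnitaryGroup (Fin n) ℂ)) (η' : ℝ), 0 ≤ η' →
      (∀ e ∈ SA, ‖coeConfig U e - coeConfig U' e‖ ≤ η') → |A U - A U'| ≤ ℓA * η')
    (hBlip : ∀ (U U' : GaugeConfig d L (Matrix.specialUnitaryGroup (Fin n) ℂ)) (η' : ℝ), 0 ≤ η' →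
      (∀ e ∈ SB, ‖coeConfig U e - coeConfig U' e‖ ≤ η') → |B U - B U'| ≤ ℓB * η')
    (hsep : ∀ e ∈ SA, ∀ e' ∈ SB, e' ∉ linkBall (2 * m) e) :
    |∫ U, A U * B U ∂(boltzmannMeasure S) - (∫ U, A U ∂(boltzmannMeasure S)) *
        ∫ U, B U ∂(boltzmannMeasure S)| ≤ 2 * (ℓA * b + a * ℓB) * η := by
  classical
  obtain ⟨hFm, hmap⟩ := hF
  rw [← hmap]
  -- the freeze approximant: read the ball, freeze the rest to the unit configuration
  set V₀ : GaugeConfig d L (Matrix.specialUnitaryGroup (Fin n) ℂ) := fun _ => 1 with hV₀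
  set Ψ : GaugeConfig d L (Matrix.specialUnitaryGroup (Fin n) ℂ) →
      GaugeConfig d L (Matrix.specialUnitaryGroup (Fin n) ℂ) :=
    fun V e => F ((linkBall m e).piecewise V V₀) e with hΨ_def
  have hΨ : ∀ e, DependsOn (fun W => Ψ W e) (linkBall m e) := by
    intro e V V' h
    have hp : (linkBall m e).piecewise V V₀ = (linkBall m e).piecewise V' V₀ :=
      dependsOn_piecewise_config (linkBall m e) V₀ h
    simp only [hΨ_def, hp]
  have hΨm : Measurable Ψ :=
    measurable_pi_iff.2 fun e =>
      (measurable_pi_apply e).comp (hFm.comp (measurable_piecewise_config (linkBall m e) V₀))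
  have hδ : ∀ V e, ‖coeConfig (F V) e - coeConfig (Ψ V) e‖ ≤ η := by
    intro V e
    have h := hcone e V ((linkBall m e).piecewise V V₀)
      (fun e' he' => (piecewise_config_eq_of_mem (linkBall m e) V V₀ he').symm)
    simpa only [coeConfig_apply, hΨ_def] using h
  have hδA : ∀ V, |A (F V) - A (Ψ V)| ≤ ℓA * η := fun V => hAlip _ _ η hη fun e _ => hδ V e
  have hδB : ∀ V, |B (F V) - B (Ψ V)| ≤ ℓB * η := fun V => hBlip _ _ η hη fun e _ => hδ V e
  have key := abs_cov_pushforward_le_of_approx_of_disjoint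
    (haarProbability (Matrix.specialUnitaryGroup (Fin n) ℂ)) hFm hΨm hΨ hAm hBm hAa hBb
    (dependsOn_of_linkLipschitz hAlip) (dependsOn_of_linkLipschitz hBlip)
    (disjoint_readClosure_linkBall hsep) hδA hδB
  calc _ ≤ 2 * (ℓA * η * b + a * (ℓB * η)) := key
    _ = 2 * (ℓA * b + a * ℓB) * η := by ring

/-- **THEOREM C, level form.**  Same conclusion from a level-form light cone `η₀ / λ^{lvl}` (`η₀ ≥ 0`,
`λ > 0`) — the shape THEOREMS L / L-ω / L-G and the truncated-flow corollaries produce: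
`|Cov_S(A, B)| ≤ 2 (ℓ_A b + a ℓ_B) · η₀ λ^{-m}` at plaquette distance `> 2m`, i.e. exponential
clustering with rate `½ log λ` per unit plaquette distance. [ours] -/
theorem abs_cov_boltzmann_le_of_levelCone
    {S : GaugeConfig d L (Matrix.specialUnitaryGroup (Fin n) ℂ) → ℝ}
    {F : GaugeConfig d L (Matrix.specialUnitaryGroup (Fin n) ℂ) →
      GaugeConfig d L (Matrix.specialUnitaryGroup (Fin n) ℂ)}
    (hF : IsTrivializingMap S F) {lam η₀ : ℝ} (hlam : 0 < lam) (hη₀ : 0 ≤ η₀)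
    (hcone : ∀ lvl : Edge d L → ℕ, (∀ e, ∀ e' ∈ plaqNbhd e, lvl e ≤ lvl e' + 1) →
      ∀ V V' : GaugeConfig d L (Matrix.specialUnitaryGroup (Fin n) ℂ), (∀ e, 1 ≤ lvl e → V e = V' e) →
        ∀ e, ‖coeConfig (F V) e - coeConfig (F V') e‖ ≤ η₀ / lam ^ lvl e)
    (m : ℕ) {A B : GaugeConfig d L (Matrix.specialUnitaryGroup (Fin n) ℂ) → ℝ} (hAm : Measurable A)
    (hBm : Measurable B) {a b ℓA ℓB : ℝ} (hAa : ∀ U, |A U| ≤ a) (hBb : ∀ U, |B U| ≤ b)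
    {SA SB : Set (Edge d L)}
    (hAlip : ∀ (U U' : GaugeConfig d L (Matrix.specialUnitaryGroup (Fin n) ℂ)) (η' : ℝ), 0 ≤ η' →
      (∀ e ∈ SA, ‖coeConfig U e - coeConfig U' e‖ ≤ η') → |A U - A U'| ≤ ℓA * η')
    (hBlip : ∀ (U U' : GaugeConfig d L (Matrix.specialUnitaryGroup (Fin n) ℂ)) (η' : ℝ), 0 ≤ η' →
      (∀ e ∈ SB, ‖coeConfig U e - coeConfig U' e‖ ≤ η') → |B U - B U'| ≤ ℓB * η')
    (hsep : ∀ e ∈ SA, ∀ e' ∈ SB, e' ∉ linkBall (2 * m) e) :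
    |∫ U, A U * B U ∂(boltzmannMeasure S) - (∫ U, A U ∂(boltzmannMeasure S)) *
        ∫ U, B U ∂(boltzmannMeasure S)| ≤ 2 * (ℓA * b + a * ℓB) * (η₀ / lam ^ m) :=
  abs_cov_boltzmann_le_of_ballInfluence hF (div_nonneg hη₀ (pow_nonneg hlam.le m))
    (fun e₀ V V' hVV' => ballInfluence_of_levelCone hcone m e₀ V V' hVV') hAm hBm hAa hBb hAlip hBlip
    hsep

end TheoremC

/-! ## 6. Non-vacuity: link-Lipschitz observables exist (distance of one link from a reference matrix) -/

section Witness

variable {d L n : ℕ} [NeZero L]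

omit [NeZero L] in
/-- The one-link observable `U ↦ ‖U_{e₀} - M₀‖_F` is `1`-link-Lipschitz on `{e₀}` (reverse triangle
inequality). [ours] -/
theorem linkLipschitz_norm_sub (e₀ : Edge d L) (M₀ : Matrix (Fin n) (Fin n) ℂ)
    (U U' : GaugeConfig d L (Matrix.specialUnitaryGroup (Fin n) ℂ)) (η : ℝ) (_hη : 0 ≤ η)
    (h : ∀ e ∈ ({e₀} : Set (Edge d L)), ‖coeConfig U e - coeConfig U' e‖ ≤ η) :
    |‖coeConfig U e₀ - M₀‖ - ‖coeConfig U' e₀ - M₀‖| ≤ 1 * η := by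
  rw [one_mul]
  refine (abs_norm_sub_norm_le _ _).trans ?_
  have : coeConfig U e₀ - M₀ - (coeConfig U' e₀ - M₀) = coeConfig U e₀ - coeConfig U' e₀ := by abel
  rw [this]
  exact h e₀ rfl

omit [NeZero L] in
/-- … it is bounded by `n + ‖M₀‖_F` … [ours] -/
theorem abs_norm_sub_le (e₀ : Edge d L) (M₀ : Matrix (Fin n) (Fin n) ℂ)
    (U : GaugeConfig d L (Matrix.specialUnitaryGroup (Fin n) ℂ)) :
    |‖coeConfig U e₀ - M₀‖| ≤ n + ‖M₀‖ := by
  rw [abs_of_nonneg (norm_nonneg _)]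
  refine (norm_sub_le _ _).trans (add_le_add ?_ le_rfl)
  rw [coeConfig_apply]
  exact frobenius_norm_coe_SU_le (U e₀)

/-- … and measurable. [ours] -/
theorem measurable_norm_sub (e₀ : Edge d L) (M₀ : Matrix (Fin n) (Fin n) ℂ) :
    Measurable fun U : GaugeConfig d L (Matrix.specialUnitaryGroup (Fin n) ℂ) =>
      ‖coeConfig U e₀ - M₀‖ := by
  have hc : Continuous fun U : GaugeConfig d L (Matrix.specialUnitaryGroup (Fin n) ℂ) =>
      ‖coeConfig U e₀ - M₀‖ :=
    continuous_norm.comp (((continuous_apply e₀).comp continuous_coeConfig).sub continuous_const)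
  exact hc.measurable

end Witness

end Summit.Ventures.LatticeQCDFlow.TrivializingMaps
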